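import Mathlib
import Summits.Ventures.HodgeRepro.Tier4.Common.AdelicDefs
import Summits.Ventures.HodgeRepro.Tier4.Common.RowWeights
import Summits.Ventures.HodgeRepro.Tier4.Line4.L1ClassV3

/-!
# Tier4/Line4/ArchDistBounds — C-L4-ARCHDIST: the archimedean distance `archDist` is subadditive, continuous, and moves by
a bounded amount under translation by compact sets

Blind re-derivation cell `pub-hodge-repro`, Tier 4 «prove the step» (README §9–§10), seat t4-L2-p1 (gen 3; L4 service
prover; plan-4 g4 S14946 (C)(1), taken S14954).  Tree path `lean/Summits/Ventures/HodgeRepro/Tier4/Line4/ArchDistBounds.lean`.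
Imports `Line4.L1ClassV3` (`archSizeAt`, `archDist`) and `Common.RowWeights` (`adToC`, `continuous_adToC`).  Mathlib-level;
no literature.

THE VOCABULARY (plan-4 g4's §15 v3, `L1ClassV3` L90–L99): `archSizeAt W w x := ∑ᵢⱼ ‖adToC w (x)ᵢⱼ‖` — the `ℓ¹` size of the
`4×4` entries of `x ∈ G(𝔸)` read at the infinite place `w` through the ring homomorphism `Common.adToC w : 𝔸_k →+* ℂ`
(RowWeights) — and `archDist W x := ∑_w log (max 1 (archSizeAt W w x))`, the sum over the infinite places of `log⁺`.
Both are imported by name from `Line4.L1ClassV3` (p700401).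

THE STATEMENTS.  (i) `archSizeAt_mul_le`: `archSizeAt (x y) ≤ archSizeAt x · archSizeAt y` (the `ℓ¹` entry sum of a
product of matrices is bounded by the product of the sums: `‖∑ₖ aᵢₖ bₖⱼ‖ ≤ ∑ₖ ‖aᵢₖ‖ ‖bₖⱼ‖`, then `∑ⱼ ‖bₖⱼ‖ ≤ ∑ₖⱼ ‖bₖⱼ‖`);
(ii) `archDist_mul_le`: `archDist (x y) ≤ archDist x + archDist y` (`log⁺ (ab) ≤ log⁺ a + log⁺ b` for `a, b ≥ 0`);
(iii) `continuous_archDist`; (iv) `exists_archDist_le_of_isCompact`: `archDist` is bounded on compacts; (v) the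
COMPACT-SHIFT BOUND `archDist_conj_le` / `archDist_le_conj_add` / `abs_archDist_conj_sub_le`: for compact `C₁, C₂` there is
`c` with `|archDist (x⁻¹ g y) − archDist g| ≤ c` for all `x ∈ C₁`, `y ∈ C₂`, `g` — the input of L4-p2's
`poincareSummable_of_decay` (S14946 (iv)) beside the sublevel count.

Nothing here says anything about the status of the Hodge conjecture for CM abelian varieties, which is NOT proved
(HC_CM is NOT proved by anyone in this repository).
-/

set_option autoImplicit false
noncomputable section
namespace Summit.Ventures.HodgeRepro.Tier4.Line4.L1Class
open Summit.Ventures.HodgeRepro.Tier4 Summit.Ventures.HodgeRepro.Tier4.Common NumberField Topology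
open scoped Pointwise

/-! ## Submultiplicativity, subadditivity, continuity, the compact-shift bound -/

section Bounds
variable {k : Type} [Field k] [NumberField k] (W : PlaneData k)

/-- `log⁺` is subadditive: `log (max 1 (a b)) ≤ log (max 1 a) + log (max 1 b)` for `b ≥ 0`. -/
theorem log_max_one_mul_le {a b : ℝ} (hb : 0 ≤ b) :
    Real.log (max 1 (a * b)) ≤ Real.log (max 1 a) + Real.log (max 1 b) := by
  have h1 : (1 : ℝ) ≤ max 1 a := le_max_left _ _
  have h2 : (1 : ℝ) ≤ max 1 b := le_max_left _ _
  have hle : max 1 (a * b) ≤ max 1 a * max 1 b := by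
    refine max_le ?_ ?_
    · exact one_le_mul_of_one_le_of_one_le h1 h2
    · exact mul_le_mul (le_max_right _ _) (le_max_right _ _) hb (le_trans zero_le_one h1)
  rw [← Real.log_mul (by positivity) (by positivity)]
  exact Real.log_le_log (lt_of_lt_of_le zero_lt_one (le_max_left _ _)) hle

/-- `archSizeAt` is non-negative. -/
theorem archSizeAt_nonneg (w : InfinitePlace k) (x : GA W) : 0 ≤ archSizeAt W w x :=
  Finset.sum_nonneg fun _ _ => Finset.sum_nonneg fun _ _ => norm_nonneg _

/-- **(i) `archSizeAt` is submultiplicative**: the `ℓ¹` entry sum of a product is at most the product of the sums. -/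
theorem archSizeAt_mul_le (w : InfinitePlace k) (x y : GA W) :
    archSizeAt W w (x * y) ≤ archSizeAt W w x * archSizeAt W w y := by
  unfold archSizeAt
  have hentry : ∀ i j : Fin 4, Common.adToC w (GA.mat W (x * y) i j) =
      ∑ l : Fin 4, Common.adToC w (GA.mat W x i l) * Common.adToC w (GA.mat W y l j) := by
    intro i j
    rw [GA.mat_mul, Matrix.mul_apply, map_sum]
    exact Finset.sum_congr rfl fun l _ => map_mul _ _ _
  simp_rw [hentry]
  have hB : ∀ l : Fin 4, ∑ j : Fin 4, ‖Common.adToC w (GA.mat W y l j)‖ ≤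
      ∑ l' : Fin 4, ∑ j : Fin 4, ‖Common.adToC w (GA.mat W y l' j)‖ := by
    intro l
    exact Finset.single_le_sum (f := fun l' : Fin 4 => ∑ j : Fin 4, ‖Common.adToC w (GA.mat W y l' j)‖)
      (fun _ _ => Finset.sum_nonneg fun _ _ => norm_nonneg _) (Finset.mem_univ l)
  calc ∑ i : Fin 4, ∑ j : Fin 4, ‖∑ l : Fin 4, Common.adToC w (GA.mat W x i l) * Common.adToC w (GA.mat W y l j)‖
      ≤ ∑ i : Fin 4, ∑ j : Fin 4, ∑ l : Fin 4, ‖Common.adToC w (GA.mat W x i l)‖ * ‖Common.adToC w (GA.mat W y l j)‖ := by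
        refine Finset.sum_le_sum fun i _ => Finset.sum_le_sum fun j _ => ?_
        refine (norm_sum_le _ _).trans (le_of_eq ?_)
        exact Finset.sum_congr rfl fun l _ => norm_mul _ _
    _ = ∑ i : Fin 4, ∑ l : Fin 4, ‖Common.adToC w (GA.mat W x i l)‖ *
          ∑ j : Fin 4, ‖Common.adToC w (GA.mat W y l j)‖ := by
        refine Finset.sum_congr rfl fun i _ => ?_
        rw [Finset.sum_comm]
        exact Finset.sum_congr rfl fun l _ => (Finset.mul_sum _ _ _).symm
    _ ≤ ∑ i : Fin 4, ∑ l : Fin 4, ‖Common.adToC w (GA.mat W x i l)‖ *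
          ∑ l' : Fin 4, ∑ j : Fin 4, ‖Common.adToC w (GA.mat W y l' j)‖ := by
        refine Finset.sum_le_sum fun i _ => Finset.sum_le_sum fun l _ => ?_
        exact mul_le_mul_of_nonneg_left (hB l) (norm_nonneg _)
    _ = (∑ i : Fin 4, ∑ l : Fin 4, ‖Common.adToC w (GA.mat W x i l)‖) *
          ∑ l' : Fin 4, ∑ j : Fin 4, ‖Common.adToC w (GA.mat W y l' j)‖ := by
        rw [Finset.sum_mul]
        exact Finset.sum_congr rfl fun i _ => (Finset.sum_mul _ _ _).symm

/-- **(ii) `archDist` is subadditive**: `archDist (x y) ≤ archDist x + archDist y`. -/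
theorem archDist_mul_le (x y : GA W) : archDist W (x * y) ≤ archDist W x + archDist W y := by
  unfold archDist
  rw [← Finset.sum_add_distrib]
  refine Finset.sum_le_sum fun w _ => ?_
  have h1 : Real.log (max 1 (archSizeAt W w (x * y))) ≤
      Real.log (max 1 (archSizeAt W w x * archSizeAt W w y)) :=
    Real.log_le_log (lt_of_lt_of_le zero_lt_one (le_max_left _ _))
      (max_le_max le_rfl (archSizeAt_mul_le W w x y))
  exact h1.trans (log_max_one_mul_le (archSizeAt_nonneg W w y))

/-- `archSizeAt` is continuous (the entries of `G(𝔸)` are continuous, `adToC w` is continuous). -/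
theorem continuous_archSizeAt (w : InfinitePlace k) : Continuous (archSizeAt W w) := by
  unfold archSizeAt
  refine continuous_finsetSum _ fun i _ => continuous_finsetSum _ fun j _ => ?_
  exact ((continuous_adToC w).comp ((Units.continuous_val.comp continuous_subtype_val).matrix_elem i j)).norm

/-- **(iii) `archDist` is continuous.** -/
theorem continuous_archDist : Continuous (archDist W) := by
  unfold archDist
  refine continuous_finsetSum _ fun w _ => ?_
  refine Continuous.log (continuous_const.max (continuous_archSizeAt W w)) fun x => ?_
  exact ne_of_gt (lt_of_lt_of_le zero_lt_one (le_max_left _ _))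

/-- **(iv) `archDist` is bounded on compact sets.** -/
theorem exists_archDist_le_of_isCompact (C : Set (GA W)) (hC : IsCompact C) :
    ∃ c : ℝ, ∀ x ∈ C, archDist W x ≤ c := by
  obtain ⟨c, hc⟩ := hC.exists_bound_of_continuousOn (continuous_archDist W).continuousOn
  exact ⟨c, fun x hx => (le_abs_self _).trans (by simpa [Real.norm_eq_abs] using hc x hx)⟩

/-- **(v) the compact-shift bound, upper half**: for compact `C₁`, `C₂` there is `c` with
`archDist (x⁻¹ g y) ≤ archDist g + c` for all `x ∈ C₁`, `y ∈ C₂`, `g`. -/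
theorem archDist_conj_le (C₁ C₂ : Set (GA W)) (hC₁ : IsCompact C₁) (hC₂ : IsCompact C₂) :
    ∃ c : ℝ, ∀ x ∈ C₁, ∀ y ∈ C₂, ∀ g : GA W, archDist W (x⁻¹ * g * y) ≤ archDist W g + c := by
  obtain ⟨c₁, hc₁⟩ := exists_archDist_le_of_isCompact W C₁⁻¹ hC₁.inv
  obtain ⟨c₂, hc₂⟩ := exists_archDist_le_of_isCompact W C₂ hC₂
  refine ⟨c₁ + c₂, fun x hx y hy g => ?_⟩
  have h1 := archDist_mul_le W (x⁻¹ * g) y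
  have h2 := archDist_mul_le W x⁻¹ g
  have h3 := hc₁ x⁻¹ (Set.inv_mem_inv.2 hx)
  have h4 := hc₂ y hy
  linarith

/-- **(v′) the compact-shift bound, lower half**: `archDist g ≤ archDist (x⁻¹ g y) + c` (`g = x (x⁻¹ g y) y⁻¹`). -/
theorem archDist_le_conj_add (C₁ C₂ : Set (GA W)) (hC₁ : IsCompact C₁) (hC₂ : IsCompact C₂) :
    ∃ c : ℝ, ∀ x ∈ C₁, ∀ y ∈ C₂, ∀ g : GA W, archDist W g ≤ archDist W (x⁻¹ * g * y) + c := by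
  obtain ⟨c₁, hc₁⟩ := exists_archDist_le_of_isCompact W C₁ hC₁
  obtain ⟨c₂, hc₂⟩ := exists_archDist_le_of_isCompact W C₂⁻¹ hC₂.inv
  refine ⟨c₁ + c₂, fun x hx y hy g => ?_⟩
  have hg : g = x * (x⁻¹ * g * y) * y⁻¹ := by group
  have h1 := archDist_mul_le W (x * (x⁻¹ * g * y)) y⁻¹
  have h2 := archDist_mul_le W x (x⁻¹ * g * y)
  have h3 := hc₁ x hx
  have h4 := hc₂ y⁻¹ (Set.inv_mem_inv.2 hy)
  calc archDist W g = archDist W (x * (x⁻¹ * g * y) * y⁻¹) := by rw [← hg]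
    _ ≤ archDist W (x⁻¹ * g * y) + (c₁ + c₂) := by linarith

/-- **(v) packaged**: `|archDist (x⁻¹ g y) − archDist g| ≤ c` uniformly in `x ∈ C₁`, `y ∈ C₂`, `g`. -/
theorem abs_archDist_conj_sub_le (C₁ C₂ : Set (GA W)) (hC₁ : IsCompact C₁) (hC₂ : IsCompact C₂) :
    ∃ c : ℝ, ∀ x ∈ C₁, ∀ y ∈ C₂, ∀ g : GA W, |archDist W (x⁻¹ * g * y) - archDist W g| ≤ c := by
  obtain ⟨c, hc⟩ := archDist_conj_le W C₁ C₂ hC₁ hC₂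
  obtain ⟨c', hc'⟩ := archDist_le_conj_add W C₁ C₂ hC₁ hC₂
  refine ⟨max c c', fun x hx y hy g => ?_⟩
  have h1 := hc x hx y hy g
  have h2 := hc' x hx y hy g
  rw [abs_sub_le_iff]
  constructor
  · linarith [le_max_left c c']
  · linarith [le_max_right c c']

end Bounds

end Summit.Ventures.HodgeRepro.Tier4.Line4.L1Class

end
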